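import Literature.AlgebraicGeometry.Motives.TateAbelianLatticeOfEllPowerTowerProofs
import Literature.AlgebraicGeometry.Motives.AbelianVarietyIsogenyKernelDeterminesQuotient
import Literature.NumberTheory.DiophantineGeometry.AVGeomPointsDivisibleProofs
import HarnessLib

/-!
# Isomorphic members of an ℓ-power isogeny tower from an endomorphism realising the lattice relation

Theorem-only companion of `Literature.AlgebraicGeometry.Motives.TateAbelianLatticeOfEllPowerTowerProofs`
(topic `AlgebraicGeometry/Motives`; no definition, no named fact).

J. Tate, *Endomorphisms of abelian varieties over finite fields*, Invent. Math. **2** (1966), §2,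
pp. 136–137, and J. S. Milne, *Abelian Varieties* (2008), Ch. IV §2 (proof of Lemma 2.4), set up
the dictionary between the members `B n → P` of an `ℓ`-power isogeny tower onto an abelian variety
`P` over a field `K` and the `Γ_K`-stable lattices `X n = T_ℓ(f n)(T_ℓ B n) ⊆ T_ℓ P`.  The tree's
`tateSubspaceRealization_of_ellPowerTower` uses one direction of it: an ISOMORPHISM `B m ≅ B n`
yields an endomorphism `u = f n ∘ η ∘ h m` of `P` with `T_ℓ(u)(X m) = ℓᵐ X n`.  This file proves
the CONVERSE direction, which is the last step of every verification of Tate's finiteness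
hypothesis `AbelianVariety.tateHypEllPowerTower P ℓ` in a special case (finite fields in Tate's
paper; CM abelian varieties over number fields, where the realising endomorphism comes from an
`ℓ`-unit of the CM order): **if an endomorphism `e` of `P` that is invertible up to powers of `ℓ`
(`e ≫ e' = ℓᵇ`) carries `X m` onto `ℓᵃ X n`, then `B m ≅ B n` over `K`** (characteristic `0`).

## The argument (`AbelianVariety.nonempty_iso_of_ellPowerTower_of_map_range_eq`)

Put `φ₀ = f m ≫ e ≫ h n : B m → B n` and `k = a + n`.  By functoriality of `T_ℓ` and
`h n ∘ f n = ℓⁿ`, `T_ℓ(φ₀)(T_ℓ B m) = ℓᵏ T_ℓ B n`.  Hence `φ₀` kills the `ℓᵏ`-torsion of `B m(K̄)`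
(every `ℓᵏ`-torsion point is the `k`-th component of an element of the Tate module, `A(K̄)` being
divisible), so `φ₀ = [ℓᵏ] ≫ ψ` for a homomorphism `ψ : B m → B n`
(`IsIsogeny.exists_comp_eq_of_kerPoints_le_points`), and `T_ℓ ψ` is bijective.  Conversely the
kernel of `φ₀` on `K̄`-points is `ℓ`-primary (the kernels of `f m`, `e`, `h n` are killed by
`ℓᵐ`, `ℓᵇ`, `ℓⁿ`), and an `ℓ`-primary point `x` with `φ₀ x = 0` lifts to `t ∈ T_ℓ B m` with
`ℓᵏ t ∈ ℓᴺ T_ℓ B m` by the bijectivity of `T_ℓ ψ`, whence `ℓᵏ x = 0`.  So `Ker φ₀ (K̄) = B m[ℓᵏ](K̄)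
= Ker [ℓᵏ] (K̄)`, and two isogenies out of `B m` with the same kernel on geometric points have
isomorphic targets (`IsIsogeny.exists_iso_comp_eq_of_kerPoints_eq`, Mumford §7 Thm. 4): `B m ≅ B n`.

## Contents (all proved)

* `AbelianVariety.exists_proj_tateModule_eq` — every `ℓᴺ`-torsion point of `A(K̄)` is the `N`-th
  component of an element of `T_ℓ A` (divisibility of `A(K̄)`, Mumford §6 App. 2).
* `AbelianVariety.geomPointsMap_eq_zero_of_range_le_pow_smul_top`,
  `AbelianVariety.torsionPoints_le_kerPoints_of_range_le_pow_smul_top` — a homomorphism `φ` with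
  `T_ℓ(φ)(T_ℓ A) ⊆ ℓᴺ T_ℓ B` kills `A[ℓᴺ](K̄)`.
* `AbelianVariety.exists_comp_eq_of_range_tateModuleMap_le` — such a `φ` factors as `[ℓᴺ] ≫ ψ`
  (characteristic `0`).
* `AbelianVariety.range_tateModuleMap_pow_smul_id` — `T_ℓ([ℓⁿ])(T_ℓ A) = ℓⁿ T_ℓ A`.
* `AbelianVariety.nonempty_iso_of_ellPowerTower_of_map_range_eq` — the theorem above;
  `AbelianVariety.nonempty_iso_of_ellPowerTower_of_range_eq_pow_smul` — its scalar case `e = 𝟙`: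
  homothetic lattices `X m = ℓᵃ X n` give `B m ≅ B n`;
  `AbelianVariety.nonempty_iso_of_ellPowerTower_of_pow_smul_map_range_eq` — the relation with powers
  of `ℓ` on both sides, `ℓᶜ · T_ℓ(e)(X m) = ℓᵃ · X n` (cancel or absorb `ℓᶜ`).

## References

* [Tate1966Endomorphisms] J. Tate, Invent. Math. 2 (1966), §2, pp. 136–137 (the lattices `X n`,
  Hyp(k, A, ℓ) and Prop. 1).
* [MilneAV2008] J. S. Milne, *Abelian Varieties* (2008), Ch. IV §2, proof of Lemma 2.4 (p. 137).
* [MumfordAV1970] D. Mumford, *Abelian Varieties* (1970), §6 App. 2 (p. 64), §7 Thm. 4 (p. 72),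
  §19 (pp. 169–176).
-/

noncomputable section

universe u

open CategoryTheory
open scoped Pointwise AddSubgroup

namespace Literature.AlgebraicGeometry.Motives

namespace AbelianVariety

open Hom
open Literature.NumberTheory.EllipticCurves (TateModule)
open Literature.NumberTheory.EllipticCurves.TateModule

variable {K : Type u} [Field K] {A B : AbelianVariety K} (ℓ : ℕ) [Fact ℓ.Prime]

/-! ## §1 `ℓ`-power torsion points and the Tate module -/

/-- **Every `ℓᴺ`-torsion point of `A(K̄)` is the `N`-th component of an element of `T_ℓ A`**:
`A(K̄)` is divisible (Mumford §6, Application 2: `nsmul_geomPoints_surjective_of_ne_zero`), so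
`[ℓ] : A[ℓᵏ⁺¹](K̄) → A[ℓᵏ](K̄)` is onto and compatible sequences through a given torsion point exist
(`TateModule.exists_proj_eq_of_forall_exists_smul_eq`). [cite: MumfordAV1970, §6 Application 2 (p. 64) and §19 (p. 171)] -/
theorem exists_proj_tateModule_eq (N : ℕ) {x : A.geomPoints} (hx : ℓ ^ N • x = 0) :
    ∃ t : A.tateModule ℓ, proj ℓ N t = x := by
  refine exists_proj_eq_of_forall_exists_smul_eq (A := A.geomPoints) (p := ℓ) ?_ N
    (AddSubgroup.torsionBy.nsmul_iff.mpr hx)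
  intro k P hP
  obtain ⟨Q, hQ⟩ :=
    nsmul_geomPoints_surjective_of_ne_zero (A := A) ℓ (Fact.out : ℓ.Prime).ne_zero P
  refine ⟨Q, AddSubgroup.torsionBy.nsmul_iff.mpr ?_, hQ⟩
  have hP' : ℓ ^ k • P = 0 := AddSubgroup.torsionBy.nsmul_iff.mp hP
  have hQ' : ℓ • Q = P := hQ
  rw [pow_succ, mul_smul, hQ', hP']

/-- **A homomorphism whose Tate-module image is divisible by `ℓᴺ` kills the `ℓᴺ`-torsion**: if
`T_ℓ(φ)(T_ℓ A) ⊆ ℓᴺ T_ℓ B` then `φ x = 0` for every `x ∈ A(K̄)` with `ℓᴺ x = 0` (lift `x` to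
`t ∈ T_ℓ A`; the `N`-th component of `ℓᴺ s` vanishes). [cite: MumfordAV1970, §19 (pp. 171–176)] -/
theorem geomPointsMap_eq_zero_of_range_le_pow_smul_top (φ : A ⟶ B) {N : ℕ}
    (hφ : LinearMap.range (tateModuleMap ℓ φ) ≤
      (ℓ : ℤ_[ℓ]) ^ N • (⊤ : Submodule ℤ_[ℓ] (B.tateModule ℓ)))
    {x : A.geomPoints} (hx : ℓ ^ N • x = 0) : geomPointsMap φ x = 0 := by
  obtain ⟨t, rfl⟩ := exists_proj_tateModule_eq ℓ N hx
  obtain ⟨s, -, hs⟩ := (Submodule.mem_smul_pointwise_iff_exists _ _ _).mp (hφ ⟨t, rfl⟩)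
  rw [← proj_tateModuleMap, ← hs, proj_pow_smul, pow_smul_proj]

/-- The same in the language of `L`-points, `L = K̄`: `A[ℓᴺ](K̄) ≤ Ker φ (K̄)` whenever
`T_ℓ(φ)(T_ℓ A) ⊆ ℓᴺ T_ℓ B`. [cite: MumfordAV1970, §19 (pp. 171–176)] -/
theorem torsionPoints_le_kerPoints_of_range_le_pow_smul_top (φ : A ⟶ B) {N : ℕ}
    (hφ : LinearMap.range (tateModuleMap ℓ φ) ≤
      (ℓ : ℤ_[ℓ]) ^ N • (⊤ : Submodule ℤ_[ℓ] (B.tateModule ℓ))) :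
    A.torsionPoints (AlgebraicClosure K) ((ℓ ^ N : ℕ) : ℤ) ≤
      kerPoints (Literature.AlgebraicGeometry.Motives.specOver K (AlgebraicClosure K)) φ := by
  intro P hP
  rw [mem_torsionPoints_iff, zpow_natCast] at hP
  have hx : ℓ ^ N • (Additive.ofMul P : A.geomPoints) = 0 := by
    apply Additive.toMul.injective
    exact hP
  have h := geomPointsMap_eq_zero_of_range_le_pow_smul_top ℓ φ hφ hx
  rw [mem_kerPoints_iff]
  have h' := congrArg Additive.toMul h
  exact h'

/-- `T_ℓ([ℓⁿ]_A)(T_ℓ A) = ℓⁿ T_ℓ A`. [cite: MumfordAV1970, §19 (p. 172)] -/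
theorem range_tateModuleMap_pow_smul_id (A : AbelianVariety K) (n : ℕ) :
    LinearMap.range (tateModuleMap ℓ ((ℓ ^ n) • 𝟙 A)) =
      (ℓ : ℤ_[ℓ]) ^ n • (⊤ : Submodule ℤ_[ℓ] (A.tateModule ℓ)) := by
  ext z
  simp only [LinearMap.mem_range, tateModuleMap_pow_smul_id_apply]
  constructor
  · rintro ⟨w, rfl⟩
    exact (Submodule.mem_smul_pointwise_iff_exists _ _ _).mpr ⟨w, trivial, rfl⟩
  · intro hz
    obtain ⟨w, -, rfl⟩ := (Submodule.mem_smul_pointwise_iff_exists _ _ _).mp hz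
    exact ⟨w, rfl⟩

/-- **Factorisation through `[ℓᴺ]`** (characteristic `0`): a homomorphism `φ : A → B` with
`T_ℓ(φ)(T_ℓ A) ⊆ ℓᴺ T_ℓ B` is `[ℓᴺ]_A ≫ ψ` for a (unique) `ψ : A → B` — it kills `A[ℓᴺ](K̄)`
(`torsionPoints_le_kerPoints_of_range_le_pow_smul_top`) and a homomorphism factors through an
isogeny whose kernel on `K̄`-points it contains (`IsIsogeny.exists_comp_eq_of_kerPoints_le_points`,
Mumford §7 Thm. 4 / §19 Remark p. 169). [cite: MumfordAV1970, §7 Thm. 4 (p. 72) and §19 Remark (p. 169)] -/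
theorem exists_comp_eq_of_range_tateModuleMap_le [CharZero K] (φ : A ⟶ B) {N : ℕ}
    (hφ : LinearMap.range (tateModuleMap ℓ φ) ≤
      (ℓ : ℤ_[ℓ]) ^ N • (⊤ : Submodule ℤ_[ℓ] (B.tateModule ℓ))) :
    ∃ ψ : A ⟶ B, ((ℓ ^ N) • 𝟙 A) ≫ ψ = φ := by
  have hcast : ((ℓ ^ N : ℕ) : K) ≠ 0 :=
    Nat.cast_ne_zero.mpr (pow_ne_zero N (Fact.out : ℓ.Prime).ne_zero)
  refine (isIsogeny_nsmul_id_of_cast_ne_zero A (ℓ ^ N) hcast).exists_comp_eq_of_kerPoints_le_points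
    (AlgebraicClosure K) φ ?_
  rw [← natCast_zsmul, ← torsionPoints_eq_kerPoints]
  exact torsionPoints_le_kerPoints_of_range_le_pow_smul_top ℓ φ hφ

/-! ## §2 The converse lattice dictionary along an `ℓ`-power tower -/

/-- **Isomorphic members of an `ℓ`-power tower from an endomorphism realising the lattice relation**
(Tate 1966, §2, pp. 136–137; Milne, *Abelian Varieties*, IV §2, proof of Lemma 2.4 — the converse of
the direction used by `tateSubspaceRealization_of_ellPowerTower`).  Let `K` have characteristic `0`,
let `f n : B n → P`, `h n : P → B n` be an `ℓ`-power tower onto `P` (isogenies with `h n ≫ f n = ℓⁿ`,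
`f n ≫ h n = ℓⁿ`; the binders of `AbelianVariety.tateHypEllPowerTower`), and write
`X n = T_ℓ(f n)(T_ℓ B n) ⊆ T_ℓ P` — spelled `LinearMap.range (tateModuleMap ℓ (f n))`, the currency
of the dictionary `AbelianVariety.exists_isogeny_range_tateModuleMap_eq` and of the `hrange` step of
`tateSubspaceRealization_of_ellPowerTower`.  If an isogeny `e : P → P` that is invertible up to a
power of `ℓ` (`e ≫ e' = ℓᵇ`) satisfies `T_ℓ(e)(X m) = ℓᵃ X n`
(`(LinearMap.range (tateModuleMap ℓ (f m))).map (tateModuleMap ℓ e) = ℓ ^ a • LinearMap.range …`),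
then `B m ≅ B n` over `K`.  Proof: with
`φ₀ = f m ≫ e ≫ h n` and `k = a + n`, `T_ℓ(φ₀)(T_ℓ B m) = ℓᵏ T_ℓ B n`, so `φ₀ = [ℓᵏ] ≫ ψ` with
`T_ℓ ψ` bijective (`exists_comp_eq_of_range_tateModuleMap_le`); the kernel of `φ₀` on `K̄`-points
is `ℓ`-primary (killed by `ℓᵐ⁺ᵇ⁺ⁿ`) and is then forced into `B m[ℓᵏ]` by the bijectivity of
`T_ℓ ψ`; so `Ker φ₀ (K̄) = Ker [ℓᵏ] (K̄)` and `B m ≅ B n` by uniqueness of quotients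
(`IsIsogeny.exists_iso_comp_eq_of_kerPoints_eq`). [cite: Tate1966Endomorphisms, §2 pp. 136–137]
[cite: MilneAV2008, Ch. IV §2, proof of Lemma 2.4 (p. 137)] [cite: MumfordAV1970, §7 Thm. 4 (p. 72)] -/
theorem nonempty_iso_of_ellPowerTower_of_map_range_eq [CharZero K] (P : AbelianVariety K)
    (B : ℕ → AbelianVariety K) (f : ∀ n, B n ⟶ P) (h : ∀ n, P ⟶ B n)
    (hf : ∀ n, IsIsogeny (f n)) (hh : ∀ n, IsIsogeny (h n))
    (hhf : ∀ n, h n ≫ f n = (ℓ ^ n) • 𝟙 P) (hfh : ∀ n, f n ≫ h n = (ℓ ^ n) • 𝟙 (B n))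
    {m n : ℕ} (e e' : P ⟶ P) (a b : ℕ) (heI : IsIsogeny e) (he : e ≫ e' = (ℓ ^ b) • 𝟙 P)
    (hrange : (LinearMap.range (tateModuleMap ℓ (f m))).map (tateModuleMap ℓ e) =
      (ℓ : ℤ_[ℓ]) ^ a • LinearMap.range (tateModuleMap ℓ (f n))) :
    Nonempty (B m ≅ B n) := by
  classical
  -- the comparison homomorphism `φ₀ = f m ≫ e ≫ h n : B m → B n` and the exponent `k = a + n`
  set φ₀ : B m ⟶ B n := f m ≫ e ≫ h n with hφ₀
  set k : ℕ := a + n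
  have hφ₀I : IsIsogeny φ₀ := isIsogeny_comp (hf m) (isIsogeny_comp heI (hh n))
  -- `T_ℓ(φ₀)(T_ℓ B m) = ℓᵏ T_ℓ B n`
  have hTφ₀ : tateModuleMap ℓ φ₀ =
      ((tateModuleMap ℓ (h n)).comp (tateModuleMap ℓ e)).comp (tateModuleMap ℓ (f m)) := by
    rw [hφ₀, tateModuleMap_comp, tateModuleMap_comp]
  have hrangeφ₀ : LinearMap.range (tateModuleMap ℓ φ₀) =
      (ℓ : ℤ_[ℓ]) ^ k • (⊤ : Submodule ℤ_[ℓ] ((B n).tateModule ℓ)) := by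
    rw [hTφ₀, LinearMap.range_comp, Submodule.map_comp, hrange, Submodule.map_pointwise_smul,
      ← LinearMap.range_comp, ← tateModuleMap_comp, hfh n, range_tateModuleMap_pow_smul_id,
      ← mul_smul, ← pow_add]
  -- `φ₀ = [ℓᵏ] ≫ ψ`
  obtain ⟨ψ, hψ⟩ := exists_comp_eq_of_range_tateModuleMap_le ℓ φ₀ hrangeφ₀.le
  have hTψ : ∀ t, tateModuleMap ℓ φ₀ t = (ℓ : ℤ_[ℓ]) ^ k • tateModuleMap ℓ ψ t := fun t ↦ by
    rw [← hψ, tateModuleMap_comp, LinearMap.comp_apply, tateModuleMap_pow_smul_id_apply, map_smul]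
  -- `T_ℓ φ₀` is injective, hence so is `T_ℓ ψ`
  have hinjφ₀ : Function.Injective (tateModuleMap ℓ φ₀) := by
    rw [hTφ₀]
    exact (((hh n).tateModuleMap_injective ℓ).comp (heI.tateModuleMap_injective ℓ)).comp
      ((hf m).tateModuleMap_injective ℓ)
  have hinjψ : Function.Injective (tateModuleMap ℓ ψ) := by
    intro t t' htt'
    apply hinjφ₀
    rw [hTψ, hTψ, htt']
  -- `T_ℓ ψ` is surjective
  have hsurjψ : Function.Surjective (tateModuleMap ℓ ψ) := by
    intro y
    have hy : (ℓ : ℤ_[ℓ]) ^ k • y ∈ LinearMap.range (tateModuleMap ℓ φ₀) :=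
      hrangeφ₀ ▸ (Submodule.mem_smul_pointwise_iff_exists _ _ _).mpr ⟨y, trivial, rfl⟩
    obtain ⟨t, ht⟩ := hy
    refine ⟨t, ?_⟩
    have h0 : (ℓ : ℤ_[ℓ]) ^ k • (tateModuleMap ℓ ψ t - y) = 0 := by
      rw [smul_sub, ← hTψ, ht, sub_self]
    exact sub_eq_zero.mp (eq_zero_of_pow_smul_eq_zero h0)
  -- the kernel of `φ₀` on `K̄`-points is the `ℓᵏ`-torsion
  have hcast : ((ℓ ^ k : ℕ) : K) ≠ 0 :=
    Nat.cast_ne_zero.mpr (pow_ne_zero k (Fact.out : ℓ.Prime).ne_zero)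
  have hℓkI : IsIsogeny ((ℓ ^ k) • 𝟙 (B m)) := isIsogeny_nsmul_id_of_cast_ne_zero (B m) (ℓ ^ k) hcast
  have hker : kerPoints (Literature.AlgebraicGeometry.Motives.specOver K (AlgebraicClosure K))
        ((ℓ ^ k) • 𝟙 (B m)) =
      kerPoints (Literature.AlgebraicGeometry.Motives.specOver K (AlgebraicClosure K)) φ₀ := by
    apply le_antisymm
    · -- `B m[ℓᵏ](K̄) ≤ Ker φ₀ (K̄)`
      rw [← natCast_zsmul, ← torsionPoints_eq_kerPoints]
      exact torsionPoints_le_kerPoints_of_range_le_pow_smul_top ℓ φ₀ hrangeφ₀.le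
    · -- `Ker φ₀ (K̄) ≤ B m[ℓᵏ](K̄)`
      intro Q hQ
      rw [← natCast_zsmul, ← torsionPoints_eq_kerPoints, mem_torsionPoints_iff, zpow_natCast]
      set x : (B m).geomPoints := Additive.ofMul Q with hx
      have hx0 : geomPointsMap φ₀ x = 0 := by
        apply Additive.toMul.injective
        exact (mem_kerPoints_iff φ₀ Q).mp hQ
      -- `[c]` acts on points as `c • _`
      have hnsmul : ∀ (C : AbelianVariety K) (c : ℕ) (y : C.geomPoints),
          geomPointsMap ((c • 𝟙 C)) y = c • y := fun C c y ↦ by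
        rw [geomPointsMap_nsmul_apply, geomPointsMap_id, AddMonoidHom.id_apply]
      -- the kernel of `φ₀` is killed by `ℓᵐ ℓᵇ ℓⁿ`
      have hz : geomPointsMap (h n) (geomPointsMap e (geomPointsMap (f m) x)) = 0 := by
        rw [hφ₀, geomPointsMap_comp, geomPointsMap_comp] at hx0
        exact hx0
      have h1 : ℓ ^ n • geomPointsMap e (geomPointsMap (f m) x) = 0 := by
        calc ℓ ^ n • geomPointsMap e (geomPointsMap (f m) x)
            = geomPointsMap ((ℓ ^ n) • 𝟙 P) (geomPointsMap e (geomPointsMap (f m) x)) :=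
              (hnsmul P _ _).symm
          _ = geomPointsMap (f n) (geomPointsMap (h n) (geomPointsMap e (geomPointsMap (f m) x))) := by
              rw [← hhf n, geomPointsMap_comp, AddMonoidHom.comp_apply]
          _ = 0 := by rw [hz, AddMonoidHom.map_zero]
      have h2 : ℓ ^ b • ℓ ^ n • geomPointsMap (f m) x = 0 := by
        calc ℓ ^ b • ℓ ^ n • geomPointsMap (f m) x
            = geomPointsMap ((ℓ ^ b) • 𝟙 P) (ℓ ^ n • geomPointsMap (f m) x) := (hnsmul P _ _).symm
          _ = geomPointsMap e' (geomPointsMap e (ℓ ^ n • geomPointsMap (f m) x)) := by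
              rw [← he, geomPointsMap_comp, AddMonoidHom.comp_apply]
          _ = 0 := by rw [AddMonoidHom.map_nsmul, h1, AddMonoidHom.map_zero]
      have h2' : geomPointsMap (f m) (ℓ ^ b • ℓ ^ n • x) = 0 := by
        rw [AddMonoidHom.map_nsmul, AddMonoidHom.map_nsmul]
        exact h2
      have h3 : ℓ ^ m • ℓ ^ b • ℓ ^ n • x = 0 := by
        calc ℓ ^ m • ℓ ^ b • ℓ ^ n • x
            = geomPointsMap ((ℓ ^ m) • 𝟙 (B m)) (ℓ ^ b • ℓ ^ n • x) := (hnsmul (B m) _ _).symm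
          _ = geomPointsMap (h m) (geomPointsMap (f m) (ℓ ^ b • ℓ ^ n • x)) := by
              rw [← hfh m, geomPointsMap_comp, AddMonoidHom.comp_apply]
          _ = 0 := by rw [h2', AddMonoidHom.map_zero]
      have hN : ℓ ^ (m + b + n) • x = 0 := by
        rw [pow_add, pow_add, mul_smul, mul_smul]
        exact h3
      -- lift `x` to the Tate module and use the bijectivity of `T_ℓ ψ`
      obtain ⟨t, ht⟩ := exists_proj_tateModule_eq ℓ (m + b + n) hN
      have hproj : proj ℓ (m + b + n) (tateModuleMap ℓ φ₀ t) = 0 := by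
        rw [proj_tateModuleMap, ht]
        exact hx0
      obtain ⟨s, hs⟩ := exists_pow_smul_eq_of_proj_eq_zero hproj
      obtain ⟨s', rfl⟩ := hsurjψ s
      have hts : (ℓ : ℤ_[ℓ]) ^ k • t = (ℓ : ℤ_[ℓ]) ^ (m + b + n) • s' := by
        apply hinjψ
        rw [map_smul, map_smul, hs, hTψ]
      have hfinal : ℓ ^ k • x = 0 := by
        rw [← ht, ← proj_pow_smul, hts, proj_pow_smul, pow_smul_proj]
      have hfinal' := congrArg Additive.toMul hfinal
      exact hfinal'
  -- two isogenies out of `B m` with the same kernel on `K̄`-points have isomorphic targets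
  obtain ⟨η, -⟩ := hℓkI.exists_iso_comp_eq_of_kerPoints_eq (AlgebraicClosure K) hφ₀I hker
  exact ⟨η⟩

/-- **Homothetic lattices give isomorphic members of the tower** (the scalar case `e = 𝟙` of
`nonempty_iso_of_ellPowerTower_of_map_range_eq`; Tate 1966, §2, p. 137: «if `X' = λX` with
`λ ∈ ℚ_ℓˣ` then `B' ≅ B`»): along an `ℓ`-power tower onto `P` over a field of characteristic `0`,
`T_ℓ(f m)(T_ℓ B m) = ℓᵃ · T_ℓ(f n)(T_ℓ B n)` implies `B m ≅ B n`.  This is the base case of the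
shape-class pigeonhole in every verification of `AbelianVariety.tateHypEllPowerTower`.
[cite: Tate1966Endomorphisms, §2 pp. 136–137] [cite: MilneAV2008, Ch. IV §2, proof of Lemma 2.4 (p. 137)] -/
theorem nonempty_iso_of_ellPowerTower_of_range_eq_pow_smul [CharZero K] (P : AbelianVariety K)
    (B : ℕ → AbelianVariety K) (f : ∀ n, B n ⟶ P) (h : ∀ n, P ⟶ B n)
    (hf : ∀ n, IsIsogeny (f n)) (hh : ∀ n, IsIsogeny (h n))
    (hhf : ∀ n, h n ≫ f n = (ℓ ^ n) • 𝟙 P) (hfh : ∀ n, f n ≫ h n = (ℓ ^ n) • 𝟙 (B n))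
    {m n : ℕ} (a : ℕ)
    (hrange : LinearMap.range (tateModuleMap ℓ (f m)) =
      (ℓ : ℤ_[ℓ]) ^ a • LinearMap.range (tateModuleMap ℓ (f n))) :
    Nonempty (B m ≅ B n) :=
  nonempty_iso_of_ellPowerTower_of_map_range_eq ℓ P B f h hf hh hhf hfh (𝟙 P) (𝟙 P) a 0
    (isIsogeny_id P) (by rw [Category.comp_id, pow_zero, one_smul])
    (by rw [tateModuleMap_id, Submodule.map_id, hrange])

/-! ## §3 Brick 1′: the lattice relation up to powers of `ℓ` on both sides -/

/-- Cancellation of a power of `ℓ` on submodules of the (torsion-free) Tate module: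
`ℓᶜ U = ℓᶜ V ⟹ U = V`. [folklore] -/
private theorem pow_smul_submodule_injective (A : AbelianVariety K) (c : ℕ)
    {U V : Submodule ℤ_[ℓ] (A.tateModule ℓ)}
    (h : (ℓ : ℤ_[ℓ]) ^ c • U = (ℓ : ℤ_[ℓ]) ^ c • V) : U = V := by
  have key : ∀ {U V : Submodule ℤ_[ℓ] (A.tateModule ℓ)},
      (ℓ : ℤ_[ℓ]) ^ c • U = (ℓ : ℤ_[ℓ]) ^ c • V → U ≤ V := by
    intro U V h u hu
    have hu' : (ℓ : ℤ_[ℓ]) ^ c • u ∈ (ℓ : ℤ_[ℓ]) ^ c • V :=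
      h ▸ (Submodule.mem_smul_pointwise_iff_exists _ _ _).mpr ⟨u, hu, rfl⟩
    obtain ⟨v, hv, hvu⟩ := (Submodule.mem_smul_pointwise_iff_exists _ _ _).mp hu'
    have h0 : (ℓ : ℤ_[ℓ]) ^ c • (v - u) = 0 := by rw [smul_sub, hvu, sub_self]
    have hvu' : v = u := sub_eq_zero.mp (eq_zero_of_pow_smul_eq_zero h0)
    exact hvu' ▸ hv
  exact le_antisymm (key h) (key h.symm)

/-- **Brick 1′ — the lattice relation up to powers of `ℓ` on both sides** (the output shape of the
ideal-class/shape pigeonhole): along an `ℓ`-power tower onto `P` over a field of characteristic `0`,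
if an isogeny `e : P → P` with `e ≫ e' = ℓᵇ` satisfies `ℓᶜ · T_ℓ(e)(X m) = ℓᵃ · X n`
(`X n = T_ℓ(f n)(T_ℓ B n)`), then `B m ≅ B n`: for `c ≤ a` cancel `ℓᶜ`
(`pow_smul_submodule_injective`), for `a < c` absorb `ℓ^{c-a}` into `e`; either way
`nonempty_iso_of_ellPowerTower_of_map_range_eq` applies. [cite: Tate1966Endomorphisms, §2 pp. 136–137]
[cite: MilneAV2008, Ch. IV §2, proof of Lemma 2.4 (p. 137)] -/
theorem nonempty_iso_of_ellPowerTower_of_pow_smul_map_range_eq [CharZero K] (P : AbelianVariety K)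
    (B : ℕ → AbelianVariety K) (f : ∀ n, B n ⟶ P) (h : ∀ n, P ⟶ B n)
    (hf : ∀ n, IsIsogeny (f n)) (hh : ∀ n, IsIsogeny (h n))
    (hhf : ∀ n, h n ≫ f n = (ℓ ^ n) • 𝟙 P) (hfh : ∀ n, f n ≫ h n = (ℓ ^ n) • 𝟙 (B n))
    {m n : ℕ} (e e' : P ⟶ P) (a b c : ℕ) (heI : IsIsogeny e) (he : e ≫ e' = (ℓ ^ b) • 𝟙 P)
    (hrange : (ℓ : ℤ_[ℓ]) ^ c • (LinearMap.range (tateModuleMap ℓ (f m))).map (tateModuleMap ℓ e) =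
      (ℓ : ℤ_[ℓ]) ^ a • LinearMap.range (tateModuleMap ℓ (f n))) :
    Nonempty (B m ≅ B n) := by
  rcases le_or_gt c a with hca | hac
  · -- cancel `ℓᶜ`
    obtain ⟨d, rfl⟩ := Nat.exists_eq_add_of_le hca
    refine nonempty_iso_of_ellPowerTower_of_map_range_eq ℓ P B f h hf hh hhf hfh e e' d b heI he
      (pow_smul_submodule_injective ℓ P c ?_)
    rw [hrange, pow_add, mul_smul]
  · -- absorb `ℓ^{c-a}` into `e`
    obtain ⟨d, rfl⟩ := Nat.exists_eq_add_of_lt hac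
    have hcast : ((ℓ ^ (d + 1) : ℕ) : K) ≠ 0 :=
      Nat.cast_ne_zero.mpr (pow_ne_zero _ (Fact.out : ℓ.Prime).ne_zero)
    have he₁ : ((ℓ ^ (d + 1)) • e) ≫ e' = (ℓ ^ (d + 1 + b)) • 𝟙 P := by
      rw [Preadditive.nsmul_comp, he, ← mul_smul, ← pow_add]
    have heI₁ : IsIsogeny ((ℓ ^ (d + 1)) • e) := by
      have : (ℓ ^ (d + 1)) • e = ((ℓ ^ (d + 1)) • 𝟙 P) ≫ e := by
        rw [Preadditive.nsmul_comp, Category.id_comp]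
      rw [this]
      exact isIsogeny_comp (isIsogeny_nsmul_id_of_cast_ne_zero P _ hcast) heI
    have hpt : ∀ (j : ℕ) (w : P.tateModule ℓ),
        tateModuleMap ℓ (j • e) w = (j : ℤ_[ℓ]) • tateModuleMap ℓ e w := by
      intro j w
      induction j with
      | zero => rw [zero_smul, tateModuleMap_zero, LinearMap.zero_apply, Nat.cast_zero, zero_smul]
      | succ j ih =>
        rw [succ_nsmul, tateModuleMap_add, LinearMap.add_apply, ih, Nat.cast_succ, add_smul, one_smul]
    have hmap : (LinearMap.range (tateModuleMap ℓ (f m))).map (tateModuleMap ℓ ((ℓ ^ (d + 1)) • e)) =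
        (ℓ : ℤ_[ℓ]) ^ (d + 1) • (LinearMap.range (tateModuleMap ℓ (f m))).map (tateModuleMap ℓ e) := by
      ext z
      simp only [Submodule.mem_map, Submodule.mem_smul_pointwise_iff_exists]
      constructor
      · rintro ⟨w, hw, rfl⟩
        exact ⟨_, ⟨w, hw, rfl⟩, by rw [hpt, Nat.cast_pow]⟩
      · rintro ⟨_, ⟨w, hw, rfl⟩, rfl⟩
        exact ⟨w, hw, by rw [hpt, Nat.cast_pow]⟩
    refine nonempty_iso_of_ellPowerTower_of_map_range_eq ℓ P B f h hf hh hhf hfh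
      ((ℓ ^ (d + 1)) • e) e' 0 (d + 1 + b) heI₁ he₁ (pow_smul_submodule_injective ℓ P a ?_)
    rw [hmap, ← mul_smul, ← pow_add, pow_zero, one_smul, ← add_assoc, hrange]

end AbelianVariety

end Literature.AlgebraicGeometry.Motives

end
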